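import Literature.NumberTheory.EllipticCurves.Kriz2020.CongruentNumberDensityOneProofs
import HarnessLib

/-!
# Burungale–Tian 2026, Theorems 1.2 and 3.3 AS PRINTED: the even parity Goldfeld conjecture for `y² = x³ − x` on the classes `n ≡ 1, 2, 3 (mod 8)`

Third *proofs* companion (theorems only: no definition, no named fact, no instance; D-0026) of
`Literature.NumberTheory.EllipticCurves.BSDSelmerCMPConverse`. A. A. Burungale and Y. Tian,
*A rank zero `p`-converse to a theorem of Gross–Zagier, Kolyvagin and Rubin*, Ann. of Math. (2)
203 (2026), no. 1, 1–13 = arXiv:2506.03465v2, print (p. 2, p. 6):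

> **Theorem 1.2.** The even parity Goldfeld conjecture is true for the congruent number elliptic
> curve `E : y² = x³ − x`, that is, for a density one subset of the positive square-free integers
> `n ≡ 1, 2, 3 mod 8`, `ord_{s=1} L(s, E^{(n)}/ℚ) = 0`.
>
> **Theorem 3.3** (*"due to Smith [21, Thm. 1.2]"*, [21] = A. Smith, J. Amer. Math. Soc. 39
> (2026), 1–72). Let `E : y² = x³ − x` be the congruent number elliptic curve. Then for a density
> one subset of the square-free positive integers `n ≡ 1, 2, 3 mod 8`,
> `corank_{ℤ_2} Sel_{2^∞}(E^{(n)}/ℚ) = 0`.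
>
> *Proof of Theorem 1.2.* This is a consequence of Theorem 3.3 and the `2`-converse Theorem 1.1.

The sibling `BSDSelmerCMPConverseGoldfeldProofs` proves the both-signs / all-residues reading
"`r_an(E^d) = 0` for density `1/2` of the squarefree `d`" and flags it as "not a transcription of
Theorem 1.2"; `Kriz2020/CongruentNumberDensityOneProofs` proves "`|d| ≡ 1, 2, 3 (mod 8) ⟹ |d|` not
congruent" on a density-one set, but with Kříž's unrefereed rank-one `2`-converse as a hypothesis.
THIS file proves Theorems 3.3 and 1.2 in EXACTLY their printed normalisation,
`#{n ≤ X : n squarefree, n ≡ 1, 2, 3 (mod 8), P(n)} / #{n ≤ X : n squarefree, n ≡ 1, 2, 3 (mod 8)} ⟶ 1`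
(`n ∈ ℕ`; `P(n)` = "`corank_{ℤ_2} Sel_{2^∞}(E^{(n)}/ℚ) = 0`", resp. "`ord_{s=1} L(s, E^{(n)}/ℚ) = 0`"),
from REFEREED named facts of the tree only, each an explicit hypothesis:

* `hS : smith_selmerCorank_density (congruentNumberCurve 1)` — Smith's `2^∞`-Selmer corank
  distribution for `y² = x³ − x` (arXiv:2503.17619 Thm. 1.1; for THIS curve a consequence of the
  refereed J. Amer. Math. Soc. 39 (2026) Thm. 1.2 = [21, Thm. 1.2],
  `smith_selmerCorank_density_congruentNumberCurve_of_smith2022` — the `…_of_smith2022` twins take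
  `h22 : smith2022_selmerCorank_distribution` instead);
* `hpar : ∀ E, p_parity E 2` — `2`-parity `(-1)^{r_{2^∞}(E)} = w(E)` (Monsky 1996; Dokchitser–Dokchitser
  2010 Thm. 1.4; Smith's display (1.2)); with `w(E^{(n)}) = +1` for squarefree `n ≡ 1, 2, 3 (mod 8)`
  (Birch–Stephens — Burungale–Tian's footnote 2; tree theorem
  `rootNumber_congruentNumberCurve_eq_one_of_mod_eight`, unconditional) the corank is EVEN on these
  classes, so Smith's "`r_{2^∞} ≤ 1` with density one" reads "`r_{2^∞} = 0`" there — this is how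
  [21, Thm. 1.2], a statement about all twists, yields Theorem 3.3, a statement about the
  root-number-`+1` classes;
* `hmod : exists_isNewformOf` — Modularity, used ONLY for "the classes `1, 2, 3 (mod 8)` carry half
  of the squarefree integers" (`twistDensity_mod_eight_congruentNumber`), i.e. the printed
  denominator has positive density;
* `hBT : burungaleTian_analyticRank_eq_zero_of_selmerCorank_eq_zero_of_hasCM` — Theorem 1.1 (the
  rank-zero `2`-converse; `E^{(n)}` has CM, `j = 1728`), for Theorem 1.2 only.

Model of `E^{(n)}`. Burungale–Tian write `E^{(n)} : ny² = x³ − x`; over `ℚ` this is isomorphic to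
`y² = x³ − n²x` (`(x, y) ↦ (nx, n²y)`), the tree's `congruentNumberCurve n`, which is literally the
tree's quadratic twist `(congruentNumberCurve 1).quadraticTwist n`
(`quadraticTwist_congruentNumberCurve_one'`, `theorem_1_2_quadraticTwist`).

## References

* [BurungaleTian2026] A. A. Burungale, Y. Tian, Ann. of Math. (2) 203 (2026), 1–13 =
  arXiv:2506.03465v2: abstract, Thm. 1.2 (p. 2) with footnote 2, Thm. 3.3 and the proof of
  Thm. 1.2 (§3.2.1, p. 6).
* [Smith2026SelmerTwistI] A. Smith, J. Amer. Math. Soc. 39 (2026), 1–72 (arXiv:2207.05674),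
  Thm. 1.2 with Assumption 1.1 (3). [SmithGoldfeld2025] A. Smith, arXiv:2503.17619, Thm. 1.1,
  display (1.2), Cor. 1.3.
* [DokchitserDokchitserAnnals2010] Thm. 1.4 (`p = 2`: [Monsky1996]); [KoblitzECMF1993] Ch. II §5.
-/

noncomputable section

open scoped Classical
open Filter Topology WeierstrassCurve Literature.NumberTheory.EllipticCurves.ModularForms

namespace Literature.NumberTheory.EllipticCurves

/-! ### The class `n ≡ 1, 2, 3 (mod 8)` and the model of `E^{(n)}` -/

/-- **`E₁^{(d)} = E_{|d|}`**: the quadratic twist of `y² = x³ − x` by an integer `d` is the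
congruent number curve `y² = x³ − d²x`, as Weierstrass models (`a₄ ↦ d² a₄`, `a₆ = 0`).
(Copy of the private lemma of `Kriz2020/CongruentNumberDensityOneProofs`.) [folklore] -/
private theorem quadraticTwist_congruentNumberCurve_one' (d : ℤ) :
    (congruentNumberCurve 1).quadraticTwist (d : ℚ) = congruentNumberCurve d.natAbs := by
  have hd : ((d.natAbs : ℕ) : ℚ) ^ 2 = (d : ℚ) ^ 2 := by
    rw [Nat.cast_natAbs, Int.cast_abs, sq_abs]
  ext
  · rfl
  · simp [quadraticTwist, congruentNumberCurve, WeierstrassCurve.b₂]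
  · rfl
  · simp only [quadraticTwist, congruentNumberCurve, WeierstrassCurve.b₄]
    rw [hd]; ring
  · simp [quadraticTwist, congruentNumberCurve, WeierstrassCurve.b₆]

/-- A squarefree natural number is `≢ 0, 4 (mod 8)`, so `n ≡ 1, 2, 3 (mod 8)` iff
`n ≢ 5, 6, 7 (mod 8)`. [folklore] -/
private theorem mod_eight_one_two_three_iff_not {n : ℕ} (hsq : Squarefree n) :
    (n % 8 = 1 ∨ n % 8 = 2 ∨ n % 8 = 3) ↔ ¬ (n % 8 = 5 ∨ n % 8 = 6 ∨ n % 8 = 7) := by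
  have h4 : ¬ 4 ∣ n := fun h ↦ absurd (Nat.isUnit_iff.mp (hsq 2 h)) (by norm_num)
  omega

/-- **The classes `1, 2, 3 (mod 8)` carry half of the squarefree integers** (granted Modularity,
through the tree's `twistDensity_mod_eight_congruentNumber`: the complementary classes `5, 6, 7`
are the root-number-`−1` half of the twist family of `y² = x³ − x`, Murty–Murty Ch. 6 §1, and a
squarefree `|d|` is `≢ 0, 4 (mod 8)`): `{d squarefree : |d| ≡ 1, 2, 3 (mod 8)}` has density
`1/2` in the tree's `twistDensity` (squarefree `d ∈ ℤ`, both signs, ordered by `|d|`).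
[cite: MurtyMurty1997, Ch. 6 §1] -/
theorem twistDensity_natAbs_mod_eight_one_two_three (hmod : exists_isNewformOf) :
    twistDensity (fun d ↦ d.natAbs % 8 = 1 ∨ d.natAbs % 8 = 2 ∨ d.natAbs % 8 = 3) (1 / 2) := by
  have h := (twistDensity_mod_eight_congruentNumber hmod).compl
  rw [show (1 : ℝ) - 1 / 2 = 1 / 2 by norm_num] at h
  exact (twistDensity_congr
    (P := fun d ↦ ¬ (d.natAbs % 8 = 5 ∨ d.natAbs % 8 = 6 ∨ d.natAbs % 8 = 7))
    (Q := fun d ↦ d.natAbs % 8 = 1 ∨ d.natAbs % 8 = 2 ∨ d.natAbs % 8 = 3)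
    (fun d hd ↦ (mod_eight_one_two_three_iff_not (Int.squarefree_natAbs.mpr hd)).symm) _).1 h

/-! ### Parity on the class: `r_{2^∞}(E^{(n)}) ≤ 1 ⟹ r_{2^∞}(E^{(n)}) = 0` for `n ≡ 1, 2, 3 (mod 8)` -/

/-- **On the root-number-`+1` classes the corank is even, hence `≤ 1` means `= 0`.** For a
squarefree `n ≡ 1, 2, 3 (mod 8)`, `w(E_n) = +1` (Birch–Stephens 1966 / Koblitz Ch. II §5;
tree theorem `rootNumber_congruentNumberCurve_eq_one_of_mod_eight`, unconditional), so by the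
`2`-parity theorem `(-1)^{r_{2^∞}(E_n)} = w(E_n)` (`hpar`, Monsky 1996 = Smith's display (1.2))
`r_{2^∞}(E_n) = corank_{ℤ_2} Sel_{2^∞}(E_n/ℚ)` is even; if it is `≤ 1` it is `0`.
[cite: BurungaleTian2026, footnote 2 (p. 2)] [cite: SmithGoldfeld2025, §1 display (1.2)]
[cite: KoblitzECMF1993, Ch. II §5] -/
theorem selmerCorank_two_congruentNumberCurve_eq_zero_of_le_one
    (hpar : ∀ (E : WeierstrassCurve ℚ) [E.IsElliptic], p_parity E 2) {n : ℕ} (hsq : Squarefree n)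
    (h8 : n % 8 = 1 ∨ n % 8 = 2 ∨ n % 8 = 3) (hle : (congruentNumberCurve n).selmerCorank 2 ≤ 1) :
    (congruentNumberCurve n).selmerCorank 2 = 0 := by
  haveI := isElliptic_congruentNumberCurve hsq.ne_zero
  haveI : Fact (Nat.Prime 2) := ⟨Nat.prime_two⟩
  have hw : (congruentNumberCurve n).rootNumber = 1 :=
    rootNumber_congruentNumberCurve_eq_one_of_mod_eight hsq h8
  have h2 : (-1 : ℤ) ^ (congruentNumberCurve n).selmerCorank 2 = (congruentNumberCurve n).rootNumber :=
    hpar _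
  rw [hw, neg_one_pow_eq_one_iff_even (by norm_num)] at h2
  obtain ⟨k, hk⟩ := h2
  omega

/-- **Theorem 3.3 in the tree's density currency.** Granted `2`-parity (`hpar`) and Smith's
corank distribution for `y² = x³ − x` (`hS`): on a set of squarefree `d ∈ ℤ` of density one,
`|d| ≡ 1, 2, 3 (mod 8) ⟹ corank_{ℤ_2} Sel_{2^∞}(E_{|d|}/ℚ) = 0` (Smith: `r_{2^∞}(E^d) ≤ 1` on a
density-one set; `E^d = E_{|d|}`; parity upgrades `≤ 1` to `= 0` on the class).
[cite: BurungaleTian2026, Thm. 3.3 (p. 6)] [cite: SmithGoldfeld2025, Thm. 1.1 and display (1.2)] -/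
theorem twistDensity_selmerCorank_two_eq_zero_of_mod_eight
    (hpar : ∀ (E : WeierstrassCurve ℚ) [E.IsElliptic], p_parity E 2)
    (hS : smith_selmerCorank_density (congruentNumberCurve 1)) :
    twistDensity (fun d ↦ (d.natAbs % 8 = 1 ∨ d.natAbs % 8 = 2 ∨ d.natAbs % 8 = 3) →
      (congruentNumberCurve d.natAbs).selmerCorank 2 = 0) 1 := by
  haveI := isElliptic_congruentNumberCurve one_ne_zero
  refine twistDensity_one_mono (fun d hsq hRd h8 ↦ ?_)
    (twistDensity_selmerCorankTwoInfty_le_one_of (congruentNumberCurve 1) hS)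
  obtain ⟨-, hle⟩ := hRd
  rw [selmerCorankTwoInfty_eq, quadraticTwist_congruentNumberCurve_one' d] at hle
  exact selmerCorank_two_congruentNumberCurve_eq_zero_of_le_one hpar (Int.squarefree_natAbs.mpr hsq)
    h8 hle

/-! ### Normalisation: conditional densities inside a class, and positive `n` instead of `d = ±n` -/

/-- Conditional density inside a class `Q` of density `δ ≠ 0`: if `Q ⟹ P` on a set of density one
then `#{d squarefree, |d| ≤ X : Q d ∧ P d} / #{d squarefree, |d| ≤ X : Q d} ⟶ 1` (`Q ∧ P` has
density `δ` too, `twistDensity.and_one`; divide). [folklore] -/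
private theorem tendsto_card_div_card_of_twistDensity {P Q : ℤ → Prop} {δ : ℝ} (hδ : δ ≠ 0)
    (hQ : twistDensity Q δ) (hQP : twistDensity (fun d ↦ Q d → P d) 1) :
    Tendsto (fun X : ℕ ↦ (Nat.card {d : ℤ | Squarefree d ∧ |d| ≤ (X : ℤ) ∧ (Q d ∧ P d)} : ℝ) /
      Nat.card {d : ℤ | Squarefree d ∧ |d| ≤ (X : ℤ) ∧ Q d}) atTop (𝓝 1) := by
  have hQP' : twistDensity (fun d ↦ Q d ∧ P d) δ :=
    (twistDensity_congr (P := fun d ↦ Q d ∧ (Q d → P d)) (Q := fun d ↦ Q d ∧ P d)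
      (fun d _ ↦ ⟨fun h ↦ ⟨h.1, h.2 h.1⟩, fun h ↦ ⟨h.1, fun _ ↦ h.2⟩⟩) δ).1 (hQ.and_one hQP)
  have h := hQP'.div hQ hδ
  rw [div_self hδ] at h
  refine h.congr' ?_
  filter_upwards [eventually_ge_atTop 1] with X hX
  have hS : (Nat.card {d : ℤ | Squarefree d ∧ |d| ≤ (X : ℤ)} : ℝ) ≠ 0 := by
    have hfin : ({d : ℤ | Squarefree d ∧ |d| ≤ (X : ℤ)}).Finite :=
      (Set.finite_Icc (-(X : ℤ)) X).subset fun d hd ↦ abs_le.mp hd.2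
    have h1 : (1 : ℤ) ∈ {d : ℤ | Squarefree d ∧ |d| ≤ (X : ℤ)} :=
      ⟨squarefree_one, by simpa using hX⟩
    haveI : Finite {d : ℤ | Squarefree d ∧ |d| ≤ (X : ℤ)} := hfin.to_subtype
    have hne : Nat.card {d : ℤ | Squarefree d ∧ |d| ≤ (X : ℤ)} ≠ 0 :=
      Nat.card_ne_zero.mpr ⟨⟨⟨1, h1⟩⟩, inferInstance⟩
    exact_mod_cast hne
  simp only [Pi.div_apply]
  rw [div_div_div_cancel_right₀ hS]

/-- `#{d ∈ ℤ squarefree, |d| ≤ X, P |d|} = 2 · #{n ∈ ℕ squarefree, n ≤ X, P n}` (`d = ±n`; copy of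
the private lemma of `Kriz2020/CongruentNumberDensityOneProofs`). [folklore] -/
private theorem natCard_squarefree_int_eq_two_mul' (X : ℕ) (P : ℕ → Prop) :
    Nat.card {d : ℤ | Squarefree d ∧ |d| ≤ (X : ℤ) ∧ P d.natAbs} =
      2 * Nat.card {n : ℕ | Squarefree n ∧ n ≤ X ∧ P n} := by
  set S : Set ℕ := {n : ℕ | Squarefree n ∧ n ≤ X ∧ P n} with hS
  have hSfin : S.Finite := (Set.finite_Iic X).subset fun n hn ↦ hn.2.1
  have h0 : (0 : ℕ) ∉ S := fun h ↦ not_squarefree_zero h.1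
  have hT : {d : ℤ | Squarefree d ∧ |d| ≤ (X : ℤ) ∧ P d.natAbs} =
      ((fun n : ℕ ↦ (n : ℤ)) '' S) ∪ ((fun n : ℕ ↦ -(n : ℤ)) '' S) := by
    ext d
    simp only [Set.mem_setOf_eq, Set.mem_union, Set.mem_image]
    constructor
    · rintro ⟨hsq, hle, hP⟩
      have hsq' : Squarefree d.natAbs := Int.squarefree_natAbs.2 hsq
      have hle' : d.natAbs ≤ X := by
        rw [Int.abs_eq_natAbs] at hle
        exact_mod_cast hle
      rcases Int.natAbs_eq d with h | h
      · exact Or.inl ⟨d.natAbs, ⟨hsq', hle', hP⟩, h.symm⟩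
      · exact Or.inr ⟨d.natAbs, ⟨hsq', hle', hP⟩, h.symm⟩
    · rintro (⟨n, ⟨hsq, hle, hP⟩, rfl⟩ | ⟨n, ⟨hsq, hle, hP⟩, rfl⟩)
      · refine ⟨Int.squarefree_natCast.2 hsq, ?_, by simpa using hP⟩
        rw [Nat.abs_cast]; exact_mod_cast hle
      · refine ⟨Int.squarefree_natAbs.1 (by simpa using hsq), ?_, by simpa using hP⟩
        rw [abs_neg, Nat.abs_cast]; exact_mod_cast hle
  have hdisj : Disjoint ((fun n : ℕ ↦ (n : ℤ)) '' S) ((fun n : ℕ ↦ -(n : ℤ)) '' S) := by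
    rw [Set.disjoint_left]
    rintro d ⟨n, hn, rfl⟩ ⟨m, hm, hnm⟩
    have : (n : ℤ) = 0 := by
      have h1 : (0 : ℤ) ≤ n := by positivity
      have h2 : (0 : ℤ) ≤ m := by positivity
      linarith
    have hn0 : n = 0 := by exact_mod_cast this
    exact h0 (hn0 ▸ hn)
  have hinj : Function.Injective (fun n : ℕ ↦ -(n : ℤ)) := fun a b h ↦ by
    simpa using h
  rw [Nat.card_coe_set_eq, Nat.card_coe_set_eq, hT,
    Set.ncard_union_eq hdisj (hSfin.image _) (hSfin.image _),
    Set.ncard_image_of_injective S Nat.cast_injective,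
    Set.ncard_image_of_injective S hinj, two_mul]

/-- **Conditional density inside a class, over the positive integers.** For properties `P`, `Q`
of natural numbers: if `{d : Q |d|}` has density `δ ≠ 0` among the squarefree `d ∈ ℤ` and
`Q |d| ⟹ P |d|` on a set of density one, then
`#{n ≤ X : n squarefree, Q n ∧ P n} / #{n ≤ X : n squarefree, Q n} ⟶ 1` (`n ∈ ℕ`) — the
printed normalisation "for a density one subset of the square-free positive integers [in the class
`Q`]" of Burungale–Tian's Theorems 1.2 and 3.3, as a dictionary from the tree's `twistDensity`
(`tendsto_card_div_card_of_twistDensity` and the two-to-one symmetry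
`natCard_squarefree_int_eq_two_mul'`). [cite: BurungaleTian2026, Thm. 1.2 (p. 2) and Thm. 3.3 (p. 6), the phrase "density one subset of the square-free positive integers n ≡ 1, 2, 3 mod 8"] -/
theorem tendsto_card_nat_div_card_nat_of_twistDensity {P Q : ℕ → Prop} {δ : ℝ} (hδ : δ ≠ 0)
    (hQ : twistDensity (fun d ↦ Q d.natAbs) δ)
    (hQP : twistDensity (fun d ↦ Q d.natAbs → P d.natAbs) 1) :
    Tendsto (fun X : ℕ ↦ (Nat.card {n : ℕ | Squarefree n ∧ n ≤ X ∧ (Q n ∧ P n)} : ℝ) /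
      Nat.card {n : ℕ | Squarefree n ∧ n ≤ X ∧ Q n}) atTop (𝓝 1) := by
  refine (tendsto_card_div_card_of_twistDensity hδ hQ hQP).congr fun X ↦ ?_
  have e1 : (Nat.card {d : ℤ | Squarefree d ∧ |d| ≤ (X : ℤ) ∧ (Q d.natAbs ∧ P d.natAbs)} : ℝ) =
      2 * Nat.card {n : ℕ | Squarefree n ∧ n ≤ X ∧ (Q n ∧ P n)} := by
    exact_mod_cast natCard_squarefree_int_eq_two_mul' X (fun n ↦ Q n ∧ P n)
  have e2 : (Nat.card {d : ℤ | Squarefree d ∧ |d| ≤ (X : ℤ) ∧ Q d.natAbs} : ℝ) =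
      2 * Nat.card {n : ℕ | Squarefree n ∧ n ≤ X ∧ Q n} := by
    exact_mod_cast natCard_squarefree_int_eq_two_mul' X Q
  show (_ : ℝ) / _ = (_ : ℝ) / _
  rw [e1, e2, mul_div_mul_left _ _ (two_ne_zero' ℝ)]

/-! ### The printed statements -/

namespace BurungaleTian2026

/-- **Burungale–Tian 2026, Theorem 3.3, as printed** ("Let `E : y² = x³ − x` be the congruent
number elliptic curve. Then for a density one subset of the square-free positive integers
`n ≡ 1, 2, 3 mod 8`, `corank_{ℤ_2} Sel_{2^∞}(E^{(n)}/ℚ) = 0`", attributed to Smith [21, Thm. 1.2]):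
`#{n ≤ X squarefree, n ≡ 1,2,3 (8), corank_{ℤ_2} Sel_{2^∞}(E_n/ℚ) = 0} / #{n ≤ X squarefree, n ≡ 1,2,3 (8)} ⟶ 1`
(`E^{(n)} : ny² = x³ − x ≅_ℚ E_n : y² = x³ − n²x = congruentNumberCurve n`). Derived from Smith's
corank distribution for this curve (`hS`), `2`-parity (`hpar`, Smith's (1.2)) with
`w(E_n) = +1` on these classes (footnote 2), and Modularity (`hmod`, only for the density `1/2`
of the class). [cite: BurungaleTian2026, Thm. 3.3 (p. 6)] [cite: SmithGoldfeld2025, Thm. 1.1 and display (1.2)] -/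
theorem theorem_3_3 (hmod : exists_isNewformOf)
    (hpar : ∀ (E : WeierstrassCurve ℚ) [E.IsElliptic], p_parity E 2)
    (hS : smith_selmerCorank_density (congruentNumberCurve 1)) :
    Tendsto (fun X : ℕ ↦
      (Nat.card {n : ℕ | Squarefree n ∧ n ≤ X ∧
          ((n % 8 = 1 ∨ n % 8 = 2 ∨ n % 8 = 3) ∧ (congruentNumberCurve n).selmerCorank 2 = 0)} : ℝ) /
        Nat.card {n : ℕ | Squarefree n ∧ n ≤ X ∧ (n % 8 = 1 ∨ n % 8 = 2 ∨ n % 8 = 3)})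
      atTop (𝓝 1) :=
  tendsto_card_nat_div_card_nat_of_twistDensity (Q := fun n ↦ n % 8 = 1 ∨ n % 8 = 2 ∨ n % 8 = 3)
    (P := fun n ↦ (congruentNumberCurve n).selmerCorank 2 = 0) (by norm_num)
    (twistDensity_natAbs_mod_eight_one_two_three hmod)
    (twistDensity_selmerCorank_two_eq_zero_of_mod_eight hpar hS)

/-- **Theorem 3.3 with its printed source** [21, Thm. 1.2] = A. Smith, J. Amer. Math. Soc. 39
(2026), Thm. 1.2 (`h22`; `y² = x³ − x` satisfies its Assumption 1.1 (3),
`smith_selmerCorank_density_congruentNumberCurve_of_smith2022`).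
[cite: BurungaleTian2026, Thm. 3.3 (p. 6)] [cite: Smith2026SelmerTwistI, Thm. 1.2 with Assumption 1.1 (3)] -/
theorem theorem_3_3_of_smith2022 (hmod : exists_isNewformOf)
    (hpar : ∀ (E : WeierstrassCurve ℚ) [E.IsElliptic], p_parity E 2)
    (h22 : smith2022_selmerCorank_distribution) :
    Tendsto (fun X : ℕ ↦
      (Nat.card {n : ℕ | Squarefree n ∧ n ≤ X ∧
          ((n % 8 = 1 ∨ n % 8 = 2 ∨ n % 8 = 3) ∧ (congruentNumberCurve n).selmerCorank 2 = 0)} : ℝ) /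
        Nat.card {n : ℕ | Squarefree n ∧ n ≤ X ∧ (n % 8 = 1 ∨ n % 8 = 2 ∨ n % 8 = 3)})
      atTop (𝓝 1) :=
  theorem_3_3 hmod hpar (smith_selmerCorank_density_congruentNumberCurve_of_smith2022 h22 one_ne_zero)

/-- **Theorem 1.1 at `p = 2` for one twist** `E_n` (`n ≠ 0`; CM, `j(E_n) = 1728`):
`corank_{ℤ_2} Sel_{2^∞}(E_n/ℚ) = 0 ⟹ ord_{s=1} L(E_n, s) = 0`. [cite: BurungaleTian2026, Thm. 1.1 (p. 1) and proof of Thm. 1.2 (p. 6)] -/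
theorem analyticRank_congruentNumberCurve_eq_zero_of_selmerCorank_two_eq_zero
    (hBT : burungaleTian_analyticRank_eq_zero_of_selmerCorank_eq_zero_of_hasCM) {n : ℕ} (hn : n ≠ 0)
    (h0 : (congruentNumberCurve n).selmerCorank 2 = 0) : (congruentNumberCurve n).analyticRank = 0 := by
  haveI := isElliptic_congruentNumberCurve hn
  haveI : Fact (Nat.Prime 2) := ⟨Nat.prime_two⟩
  exact hBT _ (hasCM_of_j_mem_maximalCMJInvariants_holds _
    (congruentNumberCurve_j_mem_maximalCMJInvariants n)) 2 h0

/-- **Theorem 1.2 in the tree's density currency** ("a consequence of Theorem 3.3 and the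
`2`-converse Theorem 1.1"): on a set of squarefree `d ∈ ℤ` of density one,
`|d| ≡ 1, 2, 3 (mod 8) ⟹ ord_{s=1} L(E_{|d|}, s) = 0`. [cite: BurungaleTian2026, Thm. 1.2 and its proof (pp. 2, 6)] -/
theorem twistDensity_analyticRank_eq_zero_of_mod_eight
    (hpar : ∀ (E : WeierstrassCurve ℚ) [E.IsElliptic], p_parity E 2)
    (hS : smith_selmerCorank_density (congruentNumberCurve 1))
    (hBT : burungaleTian_analyticRank_eq_zero_of_selmerCorank_eq_zero_of_hasCM) :
    twistDensity (fun d ↦ (d.natAbs % 8 = 1 ∨ d.natAbs % 8 = 2 ∨ d.natAbs % 8 = 3) →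
      (congruentNumberCurve d.natAbs).analyticRank = 0) 1 :=
  twistDensity_one_mono
    (fun _ hsq h h8 ↦ analyticRank_congruentNumberCurve_eq_zero_of_selmerCorank_two_eq_zero hBT
      (Int.natAbs_ne_zero.mpr hsq.ne_zero) (h h8))
    (twistDensity_selmerCorank_two_eq_zero_of_mod_eight hpar hS)

/-- **Burungale–Tian 2026, Theorem 1.2, as printed — the first instance of the even parity
Goldfeld conjecture**: "for a density one subset of the positive square-free integers
`n ≡ 1, 2, 3 mod 8`, `ord_{s=1} L(s, E^{(n)}/ℚ) = 0`", i.e.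
`#{n ≤ X squarefree, n ≡ 1,2,3 (8), ord_{s=1} L(E_n, s) = 0} / #{n ≤ X squarefree, n ≡ 1,2,3 (8)} ⟶ 1`
as `X → ∞` (`E^{(n)} ≅_ℚ E_n = congruentNumberCurve n`; `ord_{s=1}` = the tree's `analyticRank`).
PROVED, as printed, from Theorem 3.3 (here: its inputs `hS`, `hpar`, `hmod`) and the `2`-converse
Theorem 1.1 (`hBT`); no input from an unrefereed source.
[cite: BurungaleTian2026, Thm. 1.2 (p. 2) and its proof (p. 6)] -/
theorem theorem_1_2 (hmod : exists_isNewformOf)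
    (hpar : ∀ (E : WeierstrassCurve ℚ) [E.IsElliptic], p_parity E 2)
    (hS : smith_selmerCorank_density (congruentNumberCurve 1))
    (hBT : burungaleTian_analyticRank_eq_zero_of_selmerCorank_eq_zero_of_hasCM) :
    Tendsto (fun X : ℕ ↦
      (Nat.card {n : ℕ | Squarefree n ∧ n ≤ X ∧
          ((n % 8 = 1 ∨ n % 8 = 2 ∨ n % 8 = 3) ∧ (congruentNumberCurve n).analyticRank = 0)} : ℝ) /
        Nat.card {n : ℕ | Squarefree n ∧ n ≤ X ∧ (n % 8 = 1 ∨ n % 8 = 2 ∨ n % 8 = 3)})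
      atTop (𝓝 1) :=
  tendsto_card_nat_div_card_nat_of_twistDensity (Q := fun n ↦ n % 8 = 1 ∨ n % 8 = 2 ∨ n % 8 = 3)
    (P := fun n ↦ (congruentNumberCurve n).analyticRank = 0) (by norm_num)
    (twistDensity_natAbs_mod_eight_one_two_three hmod)
    (twistDensity_analyticRank_eq_zero_of_mod_eight hpar hS hBT)

/-- **Theorem 1.2 on the fully refereed route** (Smith's input from J. Amer. Math. Soc. 39 (2026),
Thm. 1.2, `h22` — the source [21, Thm. 1.2] Burungale–Tian cite). Trust base: {Burungale–Tian
2026 Thm. 1.1, Smith JAMS 2026 Thm. 1.2, Monsky 1996 / Dokchitser–Dokchitser 2010, Modularity}.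
[cite: BurungaleTian2026, Thm. 1.2 (p. 2) and its proof (p. 6)] [cite: Smith2026SelmerTwistI, Thm. 1.2] -/
theorem theorem_1_2_of_smith2022 (hmod : exists_isNewformOf)
    (hpar : ∀ (E : WeierstrassCurve ℚ) [E.IsElliptic], p_parity E 2)
    (h22 : smith2022_selmerCorank_distribution)
    (hBT : burungaleTian_analyticRank_eq_zero_of_selmerCorank_eq_zero_of_hasCM) :
    Tendsto (fun X : ℕ ↦
      (Nat.card {n : ℕ | Squarefree n ∧ n ≤ X ∧
          ((n % 8 = 1 ∨ n % 8 = 2 ∨ n % 8 = 3) ∧ (congruentNumberCurve n).analyticRank = 0)} : ℝ) /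
        Nat.card {n : ℕ | Squarefree n ∧ n ≤ X ∧ (n % 8 = 1 ∨ n % 8 = 2 ∨ n % 8 = 3)})
      atTop (𝓝 1) :=
  theorem_1_2 hmod hpar (smith_selmerCorank_density_congruentNumberCurve_of_smith2022 h22 one_ne_zero)
    hBT

/-- **Theorem 1.2 in twist notation**: `E^{(n)}` written as the tree's quadratic twist
`(congruentNumberCurve 1).quadraticTwist n` (`= congruentNumberCurve n` as a Weierstrass model). [cite: BurungaleTian2026, Thm. 1.2 (p. 2)] -/
theorem theorem_1_2_quadraticTwist (hmod : exists_isNewformOf)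
    (hpar : ∀ (E : WeierstrassCurve ℚ) [E.IsElliptic], p_parity E 2)
    (hS : smith_selmerCorank_density (congruentNumberCurve 1))
    (hBT : burungaleTian_analyticRank_eq_zero_of_selmerCorank_eq_zero_of_hasCM) :
    Tendsto (fun X : ℕ ↦
      (Nat.card {n : ℕ | Squarefree n ∧ n ≤ X ∧ ((n % 8 = 1 ∨ n % 8 = 2 ∨ n % 8 = 3) ∧
          ((congruentNumberCurve 1).quadraticTwist (n : ℚ)).analyticRank = 0)} : ℝ) /
        Nat.card {n : ℕ | Squarefree n ∧ n ≤ X ∧ (n % 8 = 1 ∨ n % 8 = 2 ∨ n % 8 = 3)})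
      atTop (𝓝 1) := by
  have key : ∀ n : ℕ, (congruentNumberCurve 1).quadraticTwist (n : ℚ) = congruentNumberCurve n := by
    intro n
    rw [← Int.cast_natCast n, quadraticTwist_congruentNumberCurve_one', Int.natAbs_natCast]
  simp_rw [key]
  exact theorem_1_2 hmod hpar hS hBT

/-- **The abstract's form** ("For `50%` of the positive square-free integers `n`, we have
`ord_{s=1} L(s, E^{(n)}/ℚ) = 0`"): `#{n ≤ X squarefree : ord_{s=1} L(E_n, s) = 0} / #{n ≤ X squarefree} ⟶ 1/2`
over the POSITIVE integers — the tree's both-signs density-`1/2` theorem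
`twistDensity_analyticRank_eq_zero_congruentNumberCurve_of_burungaleTian` (Burungale–Tian at `2`,
Smith, Monsky's congruence `hMon`) read through the two-to-one symmetry `d = ±n`.
[cite: BurungaleTian2026, abstract (p. 1)] -/
theorem abstract_half (hBT : burungaleTian_analyticRank_eq_zero_of_selmerCorank_eq_zero_of_hasCM)
    (hMon : monsky_selmerCorank_two_mod_two_eq)
    (hS : smith_selmerCorank_density (congruentNumberCurve 1)) :
    Tendsto (fun X : ℕ ↦
      (Nat.card {n : ℕ | Squarefree n ∧ n ≤ X ∧ (congruentNumberCurve n).analyticRank = 0} : ℝ) /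
        Nat.card {n : ℕ | Squarefree n ∧ n ≤ X}) atTop (𝓝 (1 / 2)) := by
  have h := twistDensity_analyticRank_eq_zero_congruentNumberCurve_of_burungaleTian hBT hMon hS
  have h' : twistDensity (fun d ↦ (congruentNumberCurve d.natAbs).analyticRank = 0) (1 / 2) := by
    refine (twistDensity_congr (fun d hd ↦ ?_) _).1 h
    rw [quadraticTwist_congruentNumberCurve_one' d]
    exact and_iff_right hd.ne_zero
  unfold twistDensity at h'
  refine h'.congr fun X ↦ ?_
  have e1 : (Nat.card {d : ℤ | Squarefree d ∧ |d| ≤ (X : ℤ) ∧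
      (congruentNumberCurve d.natAbs).analyticRank = 0} : ℝ) =
      2 * Nat.card {n : ℕ | Squarefree n ∧ n ≤ X ∧ (congruentNumberCurve n).analyticRank = 0} := by
    exact_mod_cast natCard_squarefree_int_eq_two_mul' X (fun n ↦ (congruentNumberCurve n).analyticRank = 0)
  have e2 : (Nat.card {d : ℤ | Squarefree d ∧ |d| ≤ (X : ℤ)} : ℝ) =
      2 * Nat.card {n : ℕ | Squarefree n ∧ n ≤ X} := by
    have := natCard_squarefree_int_eq_two_mul' X (fun _ ↦ True)
    simp only [and_true] at this
    exact_mod_cast this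
  show (_ : ℝ) / _ = (_ : ℝ) / _
  rw [e1, e2, mul_div_mul_left _ _ (two_ne_zero' ℝ)]

end BurungaleTian2026

end Literature.NumberTheory.EllipticCurves

end
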